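import Mathlib
import Summits.ResolutionOfSingularities.ResolutionOfSingularities.Theorems.WeightedInvariantLocalWeightedDropPolyDescentTail
import Summits.ResolutionOfSingularities.ResolutionOfSingularities.Theorems.WeightedInvariantLocalWeightedDropPolyDescentShiftAlgebra

/-!
# `WeightedInvariant.LocalWeightedDrop`, stub S3ρ: the monic polyhedron descent — NO INFINITE Σ**_d-CHAIN (piece ρ-T = the line's sub-stub
# `stub_polyNoChain`; CJS Thm 13.7 / Claim 13.8 for `J = (y^d + Σ A_j y^j)`, `e = 2`)

Crux item stmt-ResolutionOfSingularities-8899 `LocalWeightedDrop` (route `ResolutionOfSingularities/WeightedInvariant`), registered skeleton v30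
(09f812eb3be8b7d8), stub S3ρ `stub_wildMonicSurfaceReductionWon`.  [OURS · L1 W4.3, chain w43, lead prover (gen 3); a LINE UNDER THE STUB: the
monic polyhedron descent (memo `L/res-L1-w43-lead-1/g3/S3RHO-CJS-MEMO.md`, line file `poly_descent_line_v1.lean` sha16 905148e143a15d9b, evidence on
stmt-8899: sub-stubs (ρ-P) `stub_polyPrep`, (ρ-M) `stub_polyMinimality`, (ρ-T) `stub_polyNoChain`, (ρ-B) `stub_polyBridge` + the sorry-free
composition to S3ρ verbatim).  MODEL Cossart–Jannsen–Saito LNM 2270 Ch. 11–13; nothing here is a statement of any manuscript.  Pure-power instance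
`PureDescent.noChain` (p507072), degree-2 instance `MonicDescent.monicDescentNoChain` (p493102).]

THE ONE-STEP LAWS OF THE PREPARED STRAIGHTENED CHAIN HOLD UP TO WELL-PREPARED RE-CENTRING, hence exactly on `(ε, ζ)` by minimality:
* `step_point` — at a point step `X = blowOneT (Â m)` is a well-prepared POSITION (positions of the charts by minimality against the competitor
  `shift (Â m) (ψ′ − ψ₀)` whose chart is the position `S (m+1)`: `isPosT_blowOneT_of_shift`) and `Â (m+1) = shift X χ` (`blowOneT_shift`, `shearT_shift`,
  `χ(0) = 0` because both are positions), so `ε(Â(m+1)) = ε(Â m)`, `ζ(Â(m+1)) = ζ(Â m) + ε(Â m) − d!` (`invariants_eq_of_wellPrepared`);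
* `step_curve` — at a curve step `Z = divOneT (Â m)` is a well-prepared position and `Â (m+1) = shift Z χ` (the preparing re-centring of `S m` is a
  multiple of `u₁`: `X_dvd_of_isPermissibleOneT_shift`, `divOneT_shift`), so `ε(Â(m+1)) = ε(Â m)`, `ζ(Â(m+1)) + d! = ζ(Â m)`;
* `epsL_Ahat_lt` (`ε(Â m) < d!`), `zetaL_Ahat_succ_lt` (`ζ` drops at every step), `zetaL_Ahat_add_le`;
* `stub_polyNoChain` — (ρ-T) VERBATIM: given (ρ-P) and (ρ-M), there is no infinite Σ**_d-chain of well-prepared positions with non-empty Newton set.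
-/

set_option linter.dupNamespace false -- mandated namespace of this single-conjunct summit

noncomputable section

namespace Summit.ResolutionOfSingularities.ResolutionOfSingularities.Theorems

namespace PolyDescent

open MvPowerSeries MonicDescent WildMonic Literature.RingTheory.TwoVariableSeries Literature.AlgebraicGeometry.Resolution

variable {k : Type} [Field k]

/-- The shear of a series without constant term has no constant term. -/
theorem constantCoeff_shear_eq_zero (h : MvPowerSeries (Fin 2) k) {ψ : MvPowerSeries (Fin 2) k} (hψ : constantCoeff ψ = 0) :
    constantCoeff (shear h ψ) = 0 := by
  rw [← one_le_order_iff_constCoeff_eq_zero] at hψ ⊢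
  exact le_trans hψ (PureDescent.order_le_order_shear h ψ)

section Laws

variable {d : ℕ} (hd : 0 < d) (A : ℕ → (Fin d → MvPowerSeries (Fin 2) k))
  (hprep : ∀ A : Fin d → MvPowerSeries (Fin 2) k, IsPosT d A → ∃ ψ : MvPowerSeries (Fin 2) k, IsPrepRecentring d A ψ)
  (hmin : ∀ (B : Fin d → MvPowerSeries (Fin 2) k) (ψ : MvPowerSeries (Fin 2) k), WellPrepared d B → IsPosT d B → constantCoeff ψ = 0 →
    ∀ w : Fin 2 → ℕ, (∀ i, 0 < w i) → ∀ P ∈ newtonSet B, ∃ Q ∈ newtonSet (shift d B ψ), Finsupp.weight w Q ≤ Finsupp.weight w P)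
  (hA : ∀ m, WellPrepared d (A m) ∧ IsPosT d (A m) ∧ (newtonSet (A m)).Nonempty ∧ IsNeutralStepT d (A m) (A (m + 1)))
  (hex : ∀ m, ∃ n, m ≤ n ∧ IsPointStepT A n)

include hd hprep hmin hA in
/-- POINT-STEP LAW (CJS Claim 13.8 up to well-prepared re-centring): at a point step the `u₁`-chart `X = blowOneT (Â m)` of the prepared straightened
label is a well-prepared position, `Â (m+1)` is a well-prepared re-centring of it (the shears add up in the limit coordinate, the re-centrings are carried
along by `blowOneT_shift` / `shearT_shift`), so by minimality both have the same `ε`, `ζ`: `ε(Â(m+1)) = ε(Â m)` and `ζ(Â(m+1)) = ζ(Â m) + ε(Â m) − d!`. -/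
theorem step_point {m : ℕ} (hm : IsPointStepT A m) :
    epsL (newtonSet (Ahat A hex (m + 1))) = epsL (newtonSet (Ahat A hex m)) ∧
    zetaL (newtonSet (Ahat A hex (m + 1))) = zetaL (newtonSet (Ahat A hex m)) + epsL (newtonSet (Ahat A hex m)) - d.factorial := by
  obtain ⟨ψ, hψ0, hQpos, hAeq⟩ := pointStep_shape A hprep hA hm
  -- the limit shear splits: hser m = C c + u₁ h'
  have hh'noY := hser_noY (IsPointStepT A) (param A) hex (m + 1)
  have hrel := hser_of_step (IsPointStepT A) (param A) hex hm
  -- Â m = shift (S m) ψ₀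
  obtain ⟨hψ₀0, -, -, -⟩ := prep_Slab A hprep hA hex m
  obtain ⟨hÂWP, hÂpos, hÂne, -, -⟩ := Ahat_spec A hprep hmin hA hex m
  obtain ⟨hÂ'WP, hÂ'pos, hÂ'ne, -, -⟩ := Ahat_spec A hprep hmin hA hex (m + 1)
  have hSpos : IsPosT d (Slab A hex m) := isPosT_Slab A hA hex m
  -- (1) S (m+1) = blowOneT Q' with Q' = shearT (u₁h') Q = shift (S m) ψ' = shift (Â m) (ψ' − ψ₀), a position
  set ψ' := shear (X 0 * hser (IsPointStepT A) (param A) hex (m + 1)) ψ with hψ'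
  have hψ'0 : constantCoeff ψ' = 0 := constantCoeff_shear_eq_zero _ hψ0
  have hQ'eq : shearT (X 0 * hser (IsPointStepT A) (param A) hex (m + 1)) (shift d (shearT (C (param A m)) (A m)) ψ) =
      shift d (Ahat A hex m) (ψ' - prepPsi d (Slab A hex m)) := by
    rw [shearT_shift, shearT_X_mul_shearT_C, ← hrel, Ahat_eq, shift_shift, sub_add_cancel]
    rfl
  have hQ'pos : IsPosT d (shift d (Ahat A hex m) (ψ' - prepPsi d (Slab A hex m))) := by
    rw [← hQ'eq]; exact isPosT_shearT _ hQpos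
  have hS'eq : Slab A hex (m + 1) = blowOneT d (shift d (Ahat A hex m) (ψ' - prepPsi d (Slab A hex m))) := by
    rw [← hQ'eq, blowOneT_shearT_X_mul _ _ hh'noY (sub_le_sum_of_isPosT hQpos), ← hAeq]
    rfl
  have hdiff0 : constantCoeff (ψ' - prepPsi d (Slab A hex m)) = 0 := by rw [map_sub, hψ'0, hψ₀0, sub_zero]
  -- (2) X = blowOneT (Â m) is a well-prepared position (minimality against the competitor Q')
  have hXpos : IsPosT d (blowOneT d (Ahat A hex m)) :=
    isPosT_blowOneT_of_shift hmin hÂWP hÂpos hdiff0 hQ'pos (by rw [← hS'eq]; exact isPosT_Slab A hA hex (m + 1))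
  have hXWP : WellPrepared d (blowOneT d (Ahat A hex m)) := wellPrepared_blowOneT _ hÂpos hÂWP
  have hNX : newtonSet (blowOneT d (Ahat A hex m)) = psi d.factorial '' newtonSet (Ahat A hex m) := newtonSet_blowOneT _ hÂpos
  have hXne : (newtonSet (blowOneT d (Ahat A hex m))).Nonempty := by rw [hNX]; exact hÂne.image _
  -- (3) Â (m+1) = shift X χ
  set χ := prepPsi d (Slab A hex (m + 1)) + blowOne 1 (ψ' - prepPsi d (Slab A hex m)) with hχ
  have hYeq : Ahat A hex (m + 1) = shift d (blowOneT d (Ahat A hex m)) χ := by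
    rw [hχ, ← shift_shift, ← blowOneT_shift _ _ (fun j => (hÂpos j).le) (one_le_order_iff_constCoeff_eq_zero.mpr hdiff0), ← hS'eq]
    rfl
  have hχ0 : constantCoeff χ = 0 := constantCoeff_eq_zero_of_isPosT_shift hd hXpos (by rw [← hYeq]; exact hÂ'pos)
  -- (4) minimality: same invariants
  obtain ⟨-, -, hε, hζ⟩ := invariants_eq_of_wellPrepared hmin hXWP hXpos hχ0 hXne (by rw [← hYeq]; exact hÂ'WP)
    (by rw [← hYeq]; exact hÂ'pos) (by rw [← hYeq]; exact hÂ'ne)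
  rw [hYeq, hε, hζ, hNX, epsL_image_psiC, zetaL_image_psiC (factorial_le_sum_of_isPosT hÂpos) hÂne]
  exact ⟨rfl, rfl⟩

include hd hprep hmin hA in
/-- CURVE-STEP LAW: at a curve step `Z = divOneT (Â m)` is a well-prepared position and `Â (m+1)` a well-prepared re-centring of it (the preparing
re-centring of `S m` is a multiple of `u₁`, `X_dvd_of_isPermissibleOneT_shift`, and `divOneT_shift`), so `ε(Â(m+1)) = ε(Â m)` and `ζ(Â(m+1)) + d! = ζ(Â m)`. -/
theorem step_curve {m : ℕ} (hm : ¬ IsPointStepT A m) :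
    epsL (newtonSet (Ahat A hex (m + 1))) = epsL (newtonSet (Ahat A hex m)) ∧
    zetaL (newtonSet (Ahat A hex (m + 1))) + d.factorial = zetaL (newtonSet (Ahat A hex m)) := by
  have hP1 : IsPermissibleOneT d (A m) := by unfold IsPointStepT at hm; push Not at hm; exact hm
  have hrel := hser_of_not_step (IsPointStepT A) (param A) hex hm
  obtain ⟨hÂWP, hÂpos, hÂne, -, -⟩ := Ahat_spec A hprep hmin hA hex m
  obtain ⟨hÂ'WP, hÂ'pos, hÂ'ne, -, -⟩ := Ahat_spec A hprep hmin hA hex (m + 1)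
  have hSP1 : IsPermissibleOneT d (Slab A hex m) := isPermissibleOneT_shearT _ hP1
  have hÂP1 : IsPermissibleOneT d (Ahat A hex m) := isPermissibleOneT_Ahat_of_not_isPointStepT A hprep hmin hA hex hm
  -- S (m+1) = divOneT (S m)
  have hS'eq : Slab A hex (m + 1) = divOneT d (Slab A hex m) := by
    show shearT (hser (IsPointStepT A) (param A) hex (m + 1)) (A (m + 1)) = _
    rw [hrel, succ_eq_divOneT A hA hm, ← divOneT_shearT _ hP1]
    rfl
  -- the preparing re-centring of S m is a multiple of u₁
  obtain ⟨H, hH⟩ : X 0 ∣ prepPsi d (Slab A hex m) := X_dvd_of_isPermissibleOneT_shift hd hSP1 (by rw [← Ahat_eq]; exact hÂP1)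
  -- Z = divOneT (Â m) = shift (divOneT (S m)) H and Â (m+1) = shift Z (ψ₁ − H)
  have hZeq : divOneT d (Ahat A hex m) = shift d (divOneT d (Slab A hex m)) H := by rw [Ahat_eq, hH, divOneT_shift _ _ hSP1]
  have hYeq : Ahat A hex (m + 1) = shift d (divOneT d (Ahat A hex m)) (prepPsi d (Slab A hex (m + 1)) - H) := by
    rw [hZeq, shift_shift, sub_add_cancel, Ahat_eq, hS'eq]
  -- Z is a position (minimality against the competitor shift (Â m) (u₁ (ψ₁ − H)), whose V(y,u₁)-blow-up is Â (m+1))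
  have hcomp : divOneT d (shift d (Ahat A hex m) (X 0 * (prepPsi d (Slab A hex (m + 1)) - H))) = Ahat A hex (m + 1) := by
    rw [divOneT_shift _ _ hÂP1, ← hYeq]
  have hg0 : constantCoeff (X 0 * (prepPsi d (Slab A hex (m + 1)) - H) : MvPowerSeries (Fin 2) k) = 0 := by
    rw [map_mul, constantCoeff_X, zero_mul]
  have hpos₃ : IsPosT d (divOneT d (shift d (Ahat A hex m) (X 0 * (prepPsi d (Slab A hex (m + 1)) - H)))) := by
    rw [hcomp]; exact hÂ'pos
  have hZpos : IsPosT d (divOneT d (Ahat A hex m)) :=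
    isPosT_divOneT_of_shift hmin hÂWP hÂpos hÂP1 hg0 (isPermissibleOneT_shift_X_mul hÂP1 _) hpos₃
  have hχ0 : constantCoeff (prepPsi d (Slab A hex (m + 1)) - H) = 0 :=
    constantCoeff_eq_zero_of_isPosT_shift hd hZpos (by rw [← hYeq]; exact hÂ'pos)
  have hZWP : WellPrepared d (divOneT d (Ahat A hex m)) := wellPrepared_divOneT _ hÂP1 hÂWP
  have hNZ := newtonSet_divOneT (Ahat A hex m) hÂP1
  have hZne : (newtonSet (divOneT d (Ahat A hex m))).Nonempty := by rw [hNZ]; exact hÂne.image _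
  obtain ⟨-, -, hε, hζ⟩ := invariants_eq_of_wellPrepared hmin hZWP hZpos hχ0 hZne (by rw [← hYeq]; exact hÂ'WP)
    (by rw [← hYeq]; exact hÂ'pos) (by rw [← hYeq]; exact hÂ'ne)
  rw [hYeq, hε, hζ, hNZ, epsL_image_shift (shiftOneF_snd d _) hÂne, zetaL_image_shift_add (shiftOneF_fst hÂP1) (shiftOneF_snd d _) hÂne]
  exact ⟨rfl, rfl⟩

include hd hprep hmin hA in
/-- `ε(Â m) < d!` for every `m` (curve steps keep `ε`; reduce to the next point step). -/
theorem epsL_Ahat_lt (m : ℕ) : epsL (newtonSet (Ahat A hex m)) < d.factorial := by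
  obtain ⟨n, hmn, hn⟩ := hex m
  obtain ⟨j, rfl⟩ : ∃ j, n = m + j := ⟨n - m, by omega⟩
  induction j generalizing m with
  | zero => exact epsL_Ahat_lt_of_isPointStepT A hprep hA hex (by simpa using hn)
  | succ j ih =>
    by_cases hm : IsPointStepT A m
    · exact epsL_Ahat_lt_of_isPointStepT A hprep hA hex hm
    · rw [← (step_curve hd A hprep hmin hA hex hm).1]
      exact ih (m + 1) (by omega) (by rw [show m + 1 + j = m + (j + 1) by omega]; exact hn)

include hd hprep hmin hA in
/-- `ζ` DROPS AT EVERY STEP of the prepared straightened chain: by `d! − ε ≥ 1` at a point step (`ζ′ = ζ + ε − d!`, and `ζ + ε > d!` at a position), by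
`d!` at a curve step. -/
theorem zetaL_Ahat_succ_lt (m : ℕ) : zetaL (newtonSet (Ahat A hex (m + 1))) < zetaL (newtonSet (Ahat A hex m)) := by
  obtain ⟨-, hpos, hne, -, -⟩ := Ahat_spec A hprep hmin hA hex m
  by_cases hm : IsPointStepT A m
  · obtain ⟨-, hζ⟩ := step_point hd A hprep hmin hA hex hm
    have hε := epsL_Ahat_lt hd A hprep hmin hA hex m
    obtain ⟨P, hP, hP1, hP0⟩ := exists_eq_zetaL hne
    have h := factorial_lt_sum_of_isPosT hpos P hP
    rw [hP0, hP1] at h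
    omega
  · have h := (step_curve hd A hprep hmin hA hex hm).2
    have := Nat.factorial_pos d
    omega

include hd hprep hmin hA in
/-- Hence `ζ(Â m) + m ≤ ζ(Â 0)`. -/
theorem zetaL_Ahat_add_le (m : ℕ) : zetaL (newtonSet (Ahat A hex m)) + m ≤ zetaL (newtonSet (Ahat A hex 0)) := by
  induction m with
  | zero => simp
  | succ m ih => have := zetaL_Ahat_succ_lt hd A hprep hmin hA hex m; omega

end Laws

/-- (ρ-T) NO INFINITE Σ**_d-CHAIN of well-prepared positions with non-empty Newton set, given Hironaka's vertex preparation (ρ-P) and minimality (ρ-M)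
as hypotheses: β is non-increasing and stabilises (`exists_neutral_tailT`); in the β-neutral tail there are infinitely many point steps (`α` drops by `d!` at
each curve step); straightening by the limit shear and preparing gives labels `Â m` whose one-step laws hold up to well-prepared re-centring, hence exactly
on `(ε, ζ)` by minimality; `ε(Â m) < d!` (else a graph curve), so `ζ(Â m)` drops at every step — impossible.  (CJS LNM 2270 Thm 13.7 / Claim 13.8 for
`J = (y^d + Σ A_j y^j)`, `e = 2`; degree-2 instance `MonicDescent.monicDescentNoChain` p493102, pure instance `PureDescent.noChain` p507072.)  This is the
sub-stub `stub_polyNoChain` of the line «monic polyhedron descent» under S3ρ, signature verbatim. -/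
theorem stub_polyNoChain : ∀ (k : Type) [Field k] (d : ℕ), 0 < d →
    (∀ A : Fin d → MvPowerSeries (Fin 2) k, IsPosT d A → ∃ ψ : MvPowerSeries (Fin 2) k, IsPrepRecentring d A ψ) →
    (∀ (B : Fin d → MvPowerSeries (Fin 2) k) (ψ : MvPowerSeries (Fin 2) k), WellPrepared d B → IsPosT d B → constantCoeff ψ = 0 →
      ∀ w : Fin 2 → ℕ, (∀ i, 0 < w i) → ∀ P ∈ newtonSet B, ∃ Q ∈ newtonSet (shift d B ψ), Finsupp.weight w Q ≤ Finsupp.weight w P) →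
    ¬ ∃ A : ℕ → (Fin d → MvPowerSeries (Fin 2) k), ∀ m, WellPrepared d (A m) ∧ IsPosT d (A m) ∧ (newtonSet (A m)).Nonempty ∧
      A (m + 1) ∈ succT d (A m) := by
  intro k _ d hd hprep hmin
  rintro ⟨A, hA⟩
  obtain ⟨M, hM⟩ := exists_neutral_tailT hprep hmin A hA
  set B : ℕ → (Fin d → MvPowerSeries (Fin 2) k) := fun m => A (M + m) with hB
  have hBA : ∀ m, WellPrepared d (B m) ∧ IsPosT d (B m) ∧ (newtonSet (B m)).Nonempty ∧ IsNeutralStepT d (B m) (B (m + 1)) := by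
    intro m
    obtain ⟨hwp, hpos, hne, -⟩ := hA (M + m)
    refine ⟨hwp, hpos, hne, ?_⟩
    have h := (hM (M + m) (by omega)).2
    rw [show M + m + 1 = M + (m + 1) by omega] at h
    exact h
  have hex : ∀ m, ∃ n, m ≤ n ∧ IsPointStepT B n := exists_isPointStepT_ge B hBA
  have h := zetaL_Ahat_add_le hd B hprep hmin hBA hex (zetaL (newtonSet (Ahat B hex 0)) + 1)
  omega

end PolyDescent

end Summit.ResolutionOfSingularities.ResolutionOfSingularities.Theorems

end
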